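import Summits.CriticalPhenomena.PercolationContinuityZ3.Theorems.Transplant.Slab111HubXLang
import HarnessLib

/-!
# The HUB ROUTING of the `(111)`-films, XXXI-X: DECISION TREES over pattern boxes — emptiness of boxes, the tree checker, soundness

builds on p205010 (kernel theorem, internal audit signed; external expert review pending) — NOT used in this file.  Lane `prim-bschramm`, seat
`prim-bschramm-p2` (gen 37; class C1b; memo `HOME/bschramm/P2-LATTICES.md` §135); helper file (`--supports stmt-CriticalPhenomena-4575 --as helper`).
The kernel certificate of one key of the zone-free dispatcher is a DECISION TREE over the pattern coordinates («Slab111HubXLang».`Pat`): an inner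
node splits the current interval of one coordinate into sub-intervals; a leaf says ENTRY `i` (its formula holds on the whole box, `Fm.trueOn`),
EXCLUDED by conjunct `j` of the rules formula (`falseOnD` on the box), or EMPTY (§1, `emptyB`: no configuration `(n₁,n₂,n₃,k)` with `k ≥ k_min` and
the key's class differences has its pattern in the box — interval arithmetic on the unclamped quantities).  §2 the checker `treeOK` (fuel-recursive)
and §3 its SOUNDNESS `treeOK_sound`: for every configuration in range whose pattern lies in the box and satisfies the rules, some listed formula (with
its static flag) holds at the pattern.  Generic in the leaf data: entries are pairs (static flag, formula).
[cite: DuminilCopinSidoraviciusTassion2016, §2.3 (proof of Fact 2: the three disjoint paths γ_u, γ_v, γ_w in B_R(z))]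
-/

namespace Summit.CriticalPhenomena.PercolationContinuityZ3.Theorems.Transplant

namespace Slab111

/-! ## §1 Intervals and the emptiness test -/

/-- A possibly unbounded integer interval. [folklore] -/
structure Ivl where
  (lo hi : Option ℤ)
  deriving DecidableEq, Repr

/-- Membership in an interval. [folklore] -/
def Ivl.mem (I : Ivl) (x : ℤ) : Prop := (∀ l, I.lo = some l → l ≤ x) ∧ (∀ h, I.hi = some h → x ≤ h)

/-- Sum of intervals. [folklore] -/
def Ivl.add (I J : Ivl) : Ivl :=
  ⟨(do let a ← I.lo; let b ← J.lo; pure (a + b)), (do let a ← I.hi; let b ← J.hi; pure (a + b))⟩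
/-- Negative of an interval. [folklore] -/
def Ivl.neg (I : Ivl) : Ivl := ⟨I.hi.map (fun h => -h), I.lo.map (fun l => -l)⟩
/-- Difference of intervals. [folklore] -/
def Ivl.sub (I J : Ivl) : Ivl := I.add J.neg
/-- Intersection of intervals. [folklore] -/
def Ivl.inter (I J : Ivl) : Ivl :=
  ⟨(match I.lo, J.lo with | none, b => b | a, none => a | some a, some b => some (max a b)),
   (match I.hi, J.hi with | none, b => b | a, none => a | some a, some b => some (min a b))⟩
/-- An interval with crossed bounds is empty. [folklore] -/
def Ivl.isEmpty (I : Ivl) : Bool := match I.lo, I.hi with | some a, some b => decide (b < a) | _, _ => false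

/-- Membership in a sum. [folklore] -/
theorem Ivl.mem_add {I J : Ivl} {x y : ℤ} (hx : I.mem x) (hy : J.mem y) : (I.add J).mem (x + y) := by
  obtain ⟨hx1, hx2⟩ := hx; obtain ⟨hy1, hy2⟩ := hy
  constructor
  · intro l hl
    unfold Ivl.add at hl; simp only at hl
    cases hI : I.lo <;> cases hJ : J.lo <;> simp [hI, hJ] at hl
    have := hx1 _ hI; have := hy1 _ hJ; omega
  · intro h hh
    unfold Ivl.add at hh; simp only at hh
    cases hI : I.hi <;> cases hJ : J.hi <;> simp [hI, hJ] at hh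
    have := hx2 _ hI; have := hy2 _ hJ; omega

/-- Membership in the negative. [folklore] -/
theorem Ivl.mem_neg {I : Ivl} {x : ℤ} (hx : I.mem x) : I.neg.mem (-x) := by
  obtain ⟨hx1, hx2⟩ := hx
  constructor
  · intro l hl
    unfold Ivl.neg at hl; simp only at hl
    cases hI : I.hi <;> simp [hI] at hl
    have := hx2 _ hI; omega
  · intro h hh
    unfold Ivl.neg at hh; simp only at hh
    cases hI : I.lo <;> simp [hI] at hh
    have := hx1 _ hI; omega

/-- Membership in a difference. [folklore] -/
theorem Ivl.mem_sub {I J : Ivl} {x y : ℤ} (hx : I.mem x) (hy : J.mem y) : (I.sub J).mem (x - y) := by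
  rw [sub_eq_add_neg]; exact Ivl.mem_add hx (Ivl.mem_neg hy)

/-- Membership in an intersection. [folklore] -/
theorem Ivl.mem_inter {I J : Ivl} {x : ℤ} (hx : I.mem x) (hy : J.mem x) : (I.inter J).mem x := by
  obtain ⟨hx1, hx2⟩ := hx; obtain ⟨hy1, hy2⟩ := hy
  constructor
  · intro l hl
    unfold Ivl.inter at hl; simp only at hl
    cases hI : I.lo <;> cases hJ : J.lo <;> simp [hI, hJ] at hl
    · have := hy1 _ hJ; omega
    · have := hx1 _ hI; omega
    · have := hx1 _ hI; have := hy1 _ hJ; omega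
  · intro h hh
    unfold Ivl.inter at hh; simp only at hh
    cases hI : I.hi <;> cases hJ : J.hi <;> simp [hI, hJ] at hh
    · have := hy2 _ hJ; omega
    · have := hx2 _ hI; omega
    · have := hx2 _ hI; have := hy2 _ hJ; omega

/-- An empty interval has no member. [folklore] -/
theorem Ivl.not_mem_of_isEmpty {I : Ivl} (h : I.isEmpty = true) (x : ℤ) : ¬ I.mem x := by
  intro hx
  unfold Ivl.isEmpty at h
  cases hI : I.lo <;> cases hJ : I.hi <;> simp [hI, hJ] at h
  have := hx.1 _ hI; have := hx.2 _ hJ; omega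

/-- The real values of a difference whose clamp lies in `[lo, hi]`. [folklore] -/
def unclampD (lo hi : ℤ) : Ivl := ⟨if lo ≤ -XM then none else some lo, if XM ≤ hi then none else some hi⟩
/-- The real values of a boundary distance (`≥ 0`) whose `min B ·` lies in `[lo, hi]`. [folklore] -/
def unclampB (lo hi : ℤ) : Ivl := ⟨some (max lo 0), if XB ≤ hi then none else some hi⟩

/-- Soundness of `unclampD`. [folklore] -/
theorem mem_unclampD {lo hi d : ℤ} (h1 : lo ≤ clampZ XM d) (h2 : clampZ XM d ≤ hi) : (unclampD lo hi).mem d := by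
  unfold clampZ XM at h1 h2
  constructor
  · intro l hl
    have e : (unclampD lo hi).lo = (if lo ≤ -XM then none else some lo) := rfl
    rw [e] at hl; unfold XM at hl
    by_cases hc : lo ≤ -13
    · rw [if_pos hc] at hl; exact absurd hl (by simp)
    · rw [if_neg hc] at hl; simp only [Option.some.injEq] at hl; omega
  · intro h hh
    have e : (unclampD lo hi).hi = (if XM ≤ hi then none else some hi) := rfl
    rw [e] at hh; unfold XM at hh
    by_cases hc : (13 : ℤ) ≤ hi
    · rw [if_pos hc] at hh; exact absurd hh (by simp)
    · rw [if_neg hc] at hh; simp only [Option.some.injEq] at hh; omega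

/-- Soundness of `unclampB`. [folklore] -/
theorem mem_unclampB {lo hi n : ℤ} (hn : 0 ≤ n) (h1 : lo ≤ min XB n) (h2 : min XB n ≤ hi) : (unclampB lo hi).mem n := by
  unfold XB at h1 h2
  constructor
  · intro l hl
    have e : (unclampB lo hi).lo = some (max lo 0) := rfl
    rw [e] at hl; simp only [Option.some.injEq] at hl; omega
  · intro h hh
    have e : (unclampB lo hi).hi = (if XB ≤ hi then none else some hi) := rfl
    rw [e] at hh; unfold XB at hh
    by_cases hc : (9 : ℤ) ≤ hi
    · rw [if_pos hc] at hh; exact absurd hh (by simp)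
    · rw [if_neg hc] at hh; simp only [Option.some.injEq] at hh; omega

/-- No residue-`lam` value in an interior interval of a difference coordinate. [folklore] -/
def classBad (lo hi lam : ℤ) : Bool := decide (-XM < lo) && decide (hi < XM) && allIn lo hi (fun v => decide (¬ (3 : ℤ) ∣ v - lam))

/-- **The emptiness test of a box** for configurations with `k ≥ kmin` and class differences `lam12 = λ₂ − λ₁`, `lam13 = λ₃ − λ₁`
(`3 ∣ (n₂ − n₁) − lam12`, `3 ∣ (n₃ − n₁) − lam13`). [folklore] -/
def emptyB (kmin lam12 lam13 : ℤ) (bx : Box) : Bool :=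
  let g := fun i => (bx.lo.getD i 0, bx.hi.getD i 0)
  let d12 := unclampD (g 0).1 (g 0).2
  let d13 := unclampD (g 1).1 (g 1).2
  let d23 := unclampD (g 2).1 (g 2).2
  let n1 := unclampB (g 3).1 (g 3).2
  let t1 := unclampB (g 4).1 (g 4).2
  let n2 := unclampB (g 5).1 (g 5).2
  let t2 := unclampB (g 6).1 (g 6).2
  let n3 := unclampB (g 7).1 (g 7).2
  let t3 := unclampB (g 8).1 (g 8).2
  (d23.inter (d13.sub d12)).isEmpty || (n2.inter (n1.add d12)).isEmpty || (n3.inter (n1.add d13)).isEmpty || (n3.inter (n2.add d23)).isEmpty ||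
  (d12.inter (t1.sub t2)).isEmpty || (d13.inter (t1.sub t3)).isEmpty || (d23.inter (t2.sub t3)).isEmpty ||
  ((((⟨some kmin, none⟩ : Ivl).inter (n1.add t1)).inter (n2.add t2)).inter (n3.add t3)).isEmpty ||
  classBad (g 0).1 (g 0).2 lam12 || classBad (g 1).1 (g 1).2 lam13 || classBad (g 2).1 (g 2).2 (lam13 - lam12)

/-- **Soundness of the emptiness test**: no configuration in range has its pattern in an empty box. [folklore] -/
theorem emptyB_sound {kmin lam12 lam13 : ℤ} {bx : Box} (h : emptyB kmin lam12 lam13 bx = true) {n₁ n₂ n₃ k : ℤ}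
    (h1 : 0 ≤ n₁ ∧ n₁ ≤ k) (h2 : 0 ≤ n₂ ∧ n₂ ≤ k) (h3 : 0 ≤ n₃ ∧ n₃ ≤ k) (hk : kmin ≤ k) (hc12 : (3 : ℤ) ∣ (n₂ - n₁) - lam12)
    (hc13 : (3 : ℤ) ∣ (n₃ - n₁) - lam13) : ¬ bx.mem (patOf n₁ n₂ n₃ k) := by
  intro hm
  have g : ∀ i, i ≤ 8 → bx.lo.getD i 0 ≤ (patOf n₁ n₂ n₃ k).get i ∧ (patOf n₁ n₂ n₃ k).get i ≤ bx.hi.getD i 0 := hm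
  have m0 := g 0 (by norm_num); have m1 := g 1 (by norm_num); have m2 := g 2 (by norm_num); have m3 := g 3 (by norm_num)
  have m4 := g 4 (by norm_num); have m5 := g 5 (by norm_num); have m6 := g 6 (by norm_num); have m7 := g 7 (by norm_num)
  have m8 := g 8 (by norm_num)
  simp only [patOf, Pat.get] at m0 m1 m2 m3 m4 m5 m6 m7 m8
  have e12 := mem_unclampD m0.1 m0.2; have e13 := mem_unclampD m1.1 m1.2; have e23 := mem_unclampD m2.1 m2.2
  have b1 := mem_unclampB h1.1 m3.1 m3.2; have t1 := mem_unclampB (n := k - n₁) (by omega) m4.1 m4.2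
  have b2 := mem_unclampB h2.1 m5.1 m5.2; have t2 := mem_unclampB (n := k - n₂) (by omega) m6.1 m6.2
  have b3 := mem_unclampB h3.1 m7.1 m7.2; have t3 := mem_unclampB (n := k - n₃) (by omega) m8.1 m8.2
  unfold emptyB at h
  simp only [Bool.or_eq_true] at h
  have hkI : (⟨some kmin, none⟩ : Ivl).mem k := ⟨fun l hl => by simp only [Option.some.injEq] at hl; omega, fun h hh => by simp at hh⟩
  rcases h with ((((((((((h | h) | h) | h) | h) | h) | h) | h) | h) | h) | h)
  · exact Ivl.not_mem_of_isEmpty h _ (Ivl.mem_inter e23 (by have := Ivl.mem_sub e13 e12; rwa [show n₃ - n₁ - (n₂ - n₁) = n₃ - n₂ by ring] at this))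
  · exact Ivl.not_mem_of_isEmpty h _ (Ivl.mem_inter b2 (by have := Ivl.mem_add b1 e12; rwa [show n₁ + (n₂ - n₁) = n₂ by ring] at this))
  · exact Ivl.not_mem_of_isEmpty h _ (Ivl.mem_inter b3 (by have := Ivl.mem_add b1 e13; rwa [show n₁ + (n₃ - n₁) = n₃ by ring] at this))
  · exact Ivl.not_mem_of_isEmpty h _ (Ivl.mem_inter b3 (by have := Ivl.mem_add b2 e23; rwa [show n₂ + (n₃ - n₂) = n₃ by ring] at this))
  · exact Ivl.not_mem_of_isEmpty h _ (Ivl.mem_inter e12 (by have := Ivl.mem_sub t1 t2; rwa [show k - n₁ - (k - n₂) = n₂ - n₁ by ring] at this))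
  · exact Ivl.not_mem_of_isEmpty h _ (Ivl.mem_inter e13 (by have := Ivl.mem_sub t1 t3; rwa [show k - n₁ - (k - n₃) = n₃ - n₁ by ring] at this))
  · exact Ivl.not_mem_of_isEmpty h _ (Ivl.mem_inter e23 (by have := Ivl.mem_sub t2 t3; rwa [show k - n₂ - (k - n₃) = n₃ - n₂ by ring] at this))
  · refine Ivl.not_mem_of_isEmpty h k (Ivl.mem_inter (Ivl.mem_inter (Ivl.mem_inter hkI ?_) ?_) ?_)
    · have := Ivl.mem_add b1 t1; rwa [show n₁ + (k - n₁) = k by ring] at this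
    · have := Ivl.mem_add b2 t2; rwa [show n₂ + (k - n₂) = k by ring] at this
    · have := Ivl.mem_add b3 t3; rwa [show n₃ + (k - n₃) = k by ring] at this
  all_goals
    unfold classBad at h
    simp only [Bool.and_eq_true, decide_eq_true_eq] at h
    obtain ⟨⟨hlo, hhi⟩, hall⟩ := h
  · have hv := allIn_sound hall m0.1 m0.2
    simp only [decide_eq_true_eq] at hv
    apply hv; unfold XM at hlo hhi; unfold clampZ XM at m0 ⊢
    rwa [show max (-13) (min 13 (n₂ - n₁)) = n₂ - n₁ by omega]
  · have hv := allIn_sound hall m1.1 m1.2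
    simp only [decide_eq_true_eq] at hv
    apply hv; unfold XM at hlo hhi; unfold clampZ XM at m1 ⊢
    rwa [show max (-13) (min 13 (n₃ - n₁)) = n₃ - n₁ by omega]
  · have hv := allIn_sound hall m2.1 m2.2
    simp only [decide_eq_true_eq] at hv
    apply hv; unfold XM at hlo hhi; unfold clampZ XM at m2 ⊢
    rw [show max (-13) (min 13 (n₃ - n₂)) = n₃ - n₂ by omega]
    have := dvd_sub hc13 hc12
    rwa [show n₃ - n₁ - lam13 - (n₂ - n₁ - lam12) = n₃ - n₂ - (lam13 - lam12) by ring] at this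

/-! ## §2 Boxes: the full box and restriction -/

/-- The box of all patterns. [folklore] -/
def patFullBox : Box := ⟨[-XM, -XM, -XM, 0, 0, 0, 0, 0, 0], [XM, XM, XM, XB, XB, XB, XB, XB, XB]⟩

/-- Every pattern of a configuration in range lies in the full box. [folklore] -/
theorem mem_patFullBox {n₁ n₂ n₃ k : ℤ} (h1 : 0 ≤ n₁ ∧ n₁ ≤ k) (h2 : 0 ≤ n₂ ∧ n₂ ≤ k) (h3 : 0 ≤ n₃ ∧ n₃ ≤ k) :
    patFullBox.mem (patOf n₁ n₂ n₃ k) := by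
  intro i hi
  interval_cases i <;> simp [patFullBox, patOf, Pat.get, clampZ, XM, XB] <;> omega

/-- Restricting coordinate `c` of a box to `[lo, hi]`. [folklore] -/
def Box.restrict (bx : Box) (c : ℕ) (lo hi : ℤ) : Box := ⟨bx.lo.set c lo, bx.hi.set c hi⟩

/-- Membership in a restricted box. [folklore] -/
theorem Box.mem_restrict {bx : Box} {p : Pat} (hp : bx.mem p) {c : ℕ} {lo hi : ℤ} (hlen : bx.lo.length = 9 ∧ bx.hi.length = 9)
    (h1 : lo ≤ p.get c) (h2 : p.get c ≤ hi) : (bx.restrict c lo hi).mem p := by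
  intro i hi
  unfold Box.restrict
  simp only [List.getD_eq_getElem?_getD, List.getElem?_set]
  by_cases hci : c = i
  · subst hci; simp only [if_true, show c < bx.lo.length by omega, show c < bx.hi.length by omega, Option.getD_some]; exact ⟨h1, h2⟩
  · simp only [hci, if_false]
    have := hp i hi
    simp only [List.getD_eq_getElem?_getD] at this
    exact this

/-- Restriction keeps the lengths. [folklore] -/
theorem Box.restrict_len {bx : Box} (hlen : bx.lo.length = 9 ∧ bx.hi.length = 9) (c : ℕ) (lo hi : ℤ) :
    (bx.restrict c lo hi).lo.length = 9 ∧ (bx.restrict c lo hi).hi.length = 9 := by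
  unfold Box.restrict; simp [hlen]

/-! ## §3 Trees and the checker -/

/-- **Decision trees** over pattern boxes. [folklore] -/
inductive Tree
  /-- the formula of entry `i` holds on the box -/
  | ent (i : ℕ)
  /-- conjunct `j` of the rules fails on the box -/
  | excl (j : ℕ)
  /-- the box holds no pattern of a configuration in range -/
  | emp
  /-- split coordinate `c` into the listed sub-intervals -/
  | node (c : ℕ) (kids : List (ℤ × ℤ × Tree))
  deriving Repr

/-- The children of a split cover every value of the coordinate's current interval. [folklore] -/
def coverB (bx : Box) (c : ℕ) (kids : List (ℤ × ℤ × Tree)) : Bool :=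
  allIn (bx.lo.getD c 0) (bx.hi.getD c 0) fun v => kids.any fun kd => decide (kd.1 ≤ v ∧ v ≤ kd.2.1)

/-- **The tree checker** (entries = (static flag, level formula); fuel-recursive). [folklore] -/
def treeOK (ents : List (Bool × Fm)) (rules : Fm) (kmin lam12 lam13 : ℤ) : ℕ → Box → Tree → Bool
  | 0, _, _ => false
  | _ + 1, bx, .ent i => match ents[i]? with
    | some (st, f) => st && f.ws && f.trueOn bx
    | none => false
  | _ + 1, bx, .excl j => match rules[j]? with
    | some D => Fm.ws [D] && Fm.falseOn bx [D]
    | none => false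
  | _ + 1, bx, .emp => emptyB kmin lam12 lam13 bx
  | fuel + 1, bx, .node c kids =>
    decide (c ≤ 8) && coverB bx c kids && kids.all fun kd => treeOK ents rules kmin lam12 lam13 fuel (bx.restrict c kd.1 kd.2.1) kd.2.2

/-- **SOUNDNESS OF THE TREE CHECKER**: if the tree checks on a box (with lists of length `9`), then for every configuration in range with
`k ≥ kmin`, the given class differences, all rules true at its pattern, and pattern in the box, some entry has its static flag set and its
formula true at the pattern. [folklore] -/
theorem treeOK_sound {ents : List (Bool × Fm)} {rules : Fm} {kmin lam12 lam13 : ℤ} {n₁ n₂ n₃ k : ℤ}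
    (h1 : 0 ≤ n₁ ∧ n₁ ≤ k) (h2 : 0 ≤ n₂ ∧ n₂ ≤ k) (h3 : 0 ≤ n₃ ∧ n₃ ≤ k) (hk : kmin ≤ k) (hc12 : (3 : ℤ) ∣ (n₂ - n₁) - lam12)
    (hc13 : (3 : ℤ) ∣ (n₃ - n₁) - lam13) (hrules : rules.eval (patOf n₁ n₂ n₃ k) = true) :
    ∀ (fuel : ℕ) (bx : Box) (t : Tree), bx.lo.length = 9 ∧ bx.hi.length = 9 → treeOK ents rules kmin lam12 lam13 fuel bx t = true →
      bx.mem (patOf n₁ n₂ n₃ k) → ∃ sf ∈ ents, sf.1 = true ∧ sf.2.eval (patOf n₁ n₂ n₃ k) = true := by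
  intro fuel
  induction fuel with
  | zero => intro bx t _ h; simp [treeOK] at h
  | succ fuel ih =>
    intro bx t hlen h hm
    cases t with
    | ent i =>
      unfold treeOK at h
      cases hg : ents[i]? with
      | none => rw [hg] at h; exact Bool.noConfusion h
      | some sf =>
        rw [hg] at h
        obtain ⟨st, f⟩ := sf
        simp only [Bool.and_eq_true] at h
        exact ⟨(st, f), List.mem_of_getElem? hg, h.1.1, Fm.trueOn_sound h.1.2 h.2 hm⟩
    | excl j =>
      unfold treeOK at h
      cases hg : rules[j]? with
      | none => rw [hg] at h; exact Bool.noConfusion h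
      | some D =>
        rw [hg] at h
        simp only [Bool.and_eq_true] at h
        have hf := Fm.falseOn_sound h.1 h.2 hm
        have hD : D ∈ rules := List.mem_of_getElem? hg
        unfold Fm.eval at hrules hf
        rw [List.all_eq_true] at hrules
        have := hrules D hD
        simp only [List.all_cons, List.all_nil, Bool.and_true] at hf
        rw [this] at hf; exact absurd hf (by decide)
    | emp =>
      unfold treeOK at h
      exact absurd hm (emptyB_sound h h1 h2 h3 hk hc12 hc13)
    | node c kids =>
      unfold treeOK at h
      simp only [Bool.and_eq_true, decide_eq_true_eq] at h
      obtain ⟨⟨hc, hcov⟩, hall⟩ := h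
      have hv := hm c hc
      have hcov' := allIn_sound hcov hv.1 hv.2
      rw [List.any_eq_true] at hcov'
      obtain ⟨kd, hkd, hin⟩ := hcov'
      rw [decide_eq_true_eq] at hin
      rw [List.all_eq_true] at hall
      exact ih _ _ (Box.restrict_len hlen _ _ _) (hall kd hkd) (Box.mem_restrict hm hlen hin.1 hin.2)

end Slab111

end Summit.CriticalPhenomena.PercolationContinuityZ3.Theorems.Transplant
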